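import Literature.NumberTheory.EllipticCurves.GreenbergVatsal2000.CharacterLambdaCertificateProofs
import HarnessLib

/-!
# Greenberg–Vatsal 2000 §3 (26)/(27): the `λ = 1` CERTIFICATE — `ord_T(L_{Σ₀}(C ⊗ χ, T) mod p) = 1`
# (resp. for `D`) from TWO interpolation values (THEOREMS)

HONEST FRAMING (cell `bsd-eis`, seat `bsd-eis-x3` gen 4; FULL-BSD rank-`≤ 1` programme D-0033): theorems
only, no named fact; nothing booked. The general `λ`-certificate kernel
`order_toNat_eq_of_isCharacterLFunctionC/D_of_lagrange` (`CharacterLambdaCertificateProofs.lean`,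
seat gen 3; Greenberg 2001 §4 p. 356) reads `ord_T(g mod p) = a` off `a + 1` Lagrange divided
differences of the values `characterLValueC/D p θ Σ₀ k`, `k = 1, …, a + 1`, at the nodes
`κ(γ)^{±i} − 1`. Its `a = 0` instance is `CharacterLambdaCertificateZeroProofs.lean`; this file is the
`a = 1` instance, with the two divided differences written out:
`L₀ = V₁`, `L₁ = (V₂ − V₁)/(κ(γ)^{±1} − 1)` — so `‖V₁‖ < 1` and `‖(V₂ − V₁)/(κ(γ)^{±1} − 1)‖ ≥ 1`
certify `ord_T = 1` (Greenberg's displayed congruence `g(t₁) − g(t₂) ≡ b₁(t₁ − t₂) (mod p²)`). This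
is the shape met on the X3 certificate road whenever one `Σ₀`-Euler factor of `L_{Σ₀}(C ⊗ χ, T)`
vanishes at `T = 0` (e.g. `450g2 @ 3`: the factor at `ℓ = 2`).

* `order_toNat_eq_one_of_isCharacterLFunctionC`, `order_toNat_eq_one_of_isCharacterLFunctionD`.

References: [GreenbergVatsal2000] §3 pp. 41–42 ((26), (27)); [Greenberg2001PastPresent] §4 pp. 355–356.
-/

noncomputable section

open scoped Classical

open Finset NumberField IsDedekindDomain Literature.NumberTheory.EllipticCurves

namespace Literature.NumberTheory.EllipticCurves.GreenbergVatsal2000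

variable (p : ℕ) [Fact p.Prime] {m d : ℕ} (φ : DirichletCharacter (ZMod p) m)
  (ψ : DirichletCharacter (ZMod p) d) (S₀ : Finset (HeightOneSpectrum (𝓞 ℚ)))

/-- `(range 2).erase 0 = {1}`. [folklore] -/
private theorem range_two_erase_zero : (range 2).erase 0 = {1} := by decide

/-- `(range 2).erase 1 = {0}`. [folklore] -/
private theorem range_two_erase_one : (range 2).erase 1 = {0} := by decide

/-- **`λ = 1` certificate for `L_{Σ₀}(C ⊗ χ, T)`**: with `V_k = characterLValueC p φ Σ₀ k` (GV (26) at
`T = κ(γ)^{k−1} − 1`), if `‖V₁‖ < 1` and `‖(V₂ − V₁)/(κ(γ) − 1)‖ ≥ 1` then `ord_T(g mod p) = 1` —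
the first divided difference is a unit (Greenberg 2001 p. 356: `g(t₁) − g(t₂) ≡ b₁(t₁ − t₂) (mod p²ℤ_p)`).
[cite: GreenbergVatsal2000, §3 p. 41 (26)] [cite: Greenberg2001PastPresent, §4 p. 356] -/
theorem order_toNat_eq_one_of_isCharacterLFunctionC {g : IwasawaAlgebra p}
    (hg : IsCharacterLFunctionC p φ S₀ g) (h0 : ‖characterLValueC p φ S₀ 1‖ < 1)
    (h1 : 1 ≤ ‖(characterLValueC p φ S₀ 2 - characterLValueC p φ S₀ 1) /
      (((cyclotomicGenerator p : ℕ) : ℚ_[p]) - 1)‖) :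
    (PowerSeries.map (PadicInt.toZMod (p := p)) g).order.toNat = 1 := by
  refine order_toNat_eq_of_isCharacterLFunctionC_of_lagrange p φ S₀ hg (a := 1) ?_ ?_
  · intro j hj
    have hj0 : j = 0 := by omega
    subst hj0
    simpa using h0
  · have hsum : ∑ i ∈ range (1 + 1), characterLValueC p φ S₀ (i + 1) /
        ∏ k ∈ (range (1 + 1)).erase i,
          ((((cyclotomicGenerator p : ℕ) : ℚ_[p]) ^ i - 1) -
            (((cyclotomicGenerator p : ℕ) : ℚ_[p]) ^ k - 1)) =
        (characterLValueC p φ S₀ 2 - characterLValueC p φ S₀ 1) /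
          (((cyclotomicGenerator p : ℕ) : ℚ_[p]) - 1) := by
      rw [Finset.sum_range_succ, Finset.sum_range_one, show (1 + 1 : ℕ) = 2 from rfl,
        range_two_erase_zero, range_two_erase_one, Finset.prod_singleton, Finset.prod_singleton,
        pow_zero, pow_one]
      simp only [sub_self, zero_sub, sub_zero, div_neg]
      ring
    rw [hsum]
    exact h1

/-- **`λ = 1` certificate for `L_{Σ₀}(D ⊗ χ, T)`**: with `V_k = characterLValueD p ψ Σ₀ k` (GV (27) at
`T = κ(γ)^{1−k} − 1`), if `‖V₁‖ < 1` and `‖(V₂ − V₁)/(κ(γ)⁻¹ − 1)‖ ≥ 1` then `ord_T(g mod p) = 1`.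
[cite: GreenbergVatsal2000, §3 p. 42 (27)] [cite: Greenberg2001PastPresent, §4 p. 356] -/
theorem order_toNat_eq_one_of_isCharacterLFunctionD {g : IwasawaAlgebra p}
    (hg : IsCharacterLFunctionD p ψ S₀ g) (h0 : ‖characterLValueD p ψ S₀ 1‖ < 1)
    (h1 : 1 ≤ ‖(characterLValueD p ψ S₀ 2 - characterLValueD p ψ S₀ 1) /
      ((((cyclotomicGenerator p : ℕ) : ℚ_[p])⁻¹) - 1)‖) :
    (PowerSeries.map (PadicInt.toZMod (p := p)) g).order.toNat = 1 := by
  refine order_toNat_eq_of_isCharacterLFunctionD_of_lagrange p ψ S₀ hg (a := 1) ?_ ?_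
  · intro j hj
    have hj0 : j = 0 := by omega
    subst hj0
    simpa using h0
  · have hsum : ∑ i ∈ range (1 + 1), characterLValueD p ψ S₀ (i + 1) /
        ∏ k ∈ (range (1 + 1)).erase i,
          (((((cyclotomicGenerator p : ℕ) : ℚ_[p])⁻¹) ^ i - 1) -
            ((((cyclotomicGenerator p : ℕ) : ℚ_[p])⁻¹) ^ k - 1)) =
        (characterLValueD p ψ S₀ 2 - characterLValueD p ψ S₀ 1) /
          ((((cyclotomicGenerator p : ℕ) : ℚ_[p])⁻¹) - 1) := by
      rw [Finset.sum_range_succ, Finset.sum_range_one, show (1 + 1 : ℕ) = 2 from rfl,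
        range_two_erase_zero, range_two_erase_one, Finset.prod_singleton, Finset.prod_singleton,
        pow_zero, pow_one]
      simp only [sub_self, zero_sub, sub_zero, div_neg]
      ring
    rw [hsum]
    exact h1

end Literature.NumberTheory.EllipticCurves.GreenbergVatsal2000

end
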